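import Summits.QuantumAdvantage.QuantumAdvantage.Theorems.RankDialI3
import HarnessLib

/-!
# RankDial (J1) — §25 the CLASS-BIAS interface `SpreadClassBias` (constant `1/8`, not decay), `spread_of_classBias`, `r5_of_classBias`, `classBias_of_wrank`, `bias_dial`

TARGET BY NAME (cell decomp-qadv, RESIDUAL MODE): item stmt-QuantumAdvantage-23109
`Summit.QuantumAdvantage.QuantumAdvantage.Theses.OddPrimeWalk.ManyReadersSqrtOdd`, through rung R5 = `AdviceFreeQNC0.WalkHardFLinSel p`.
This file SUPPORTS the item (`--supports`); it does not close it.  Declaration bodies are byte-identical to the cell node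
«BiasDial» (decomp-qadv lens-1, generation 26, part J; node file RankDialJ.lean = node «SpanDial» RankDialI.lean (parts G, H, I =
tree files RankDialG1–G2, H1–H3, I1–I3) followed by §25); one part J1 (§25).  See the node file for the mechanism summary.
-/

set_option linter.dupNamespace false
set_option autoImplicit false

noncomputable section
open Classical

namespace Summit.QuantumAdvantage.QuantumAdvantage.Theorems.RankDial

open Finset
open Summit.QuantumAdvantage.AdviceFreeQNC0
open Literature.Computability.MetaComplexity Literature.Computability.MetaComplexity.Smolensky

/-! ### §25 (part J «BiasDial») The CLASS-BIAS interface: what the spread residual asks of the class sums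

PART J (decomp-qadv lens-1 «grading / quantitative ladder», generation 26).  Parts C/H/I bound the live-class sums
`Σ_v (−1)^{classPar_r(v)} ω^{|v|}` of an outside fibre by something EXPONENTIALLY small and then absorb; but the
two-liveness chain (`three_mul_win_fibre_le_of_bound`) needs only `4·(1 + X) ≤ 2^ℓ`, i.e. a CONSTANT fraction
`X = 2^ℓ/8` of the trivial bound.  This part records that threshold as kernel-checked theorems with no prime and no
representation in them (`twelve_mul_win_fibre_le_of_bias`, `window_bound_of_bias`), types the resulting analytic
interface for the spread residual (`SpreadClassBias p s`: in the spread regime every live-class sum is `≤ 2^ℓ/8`),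
proves `SpreadClassBias p s → WindowSpreadLinSel p s` and hence `SpreadClassBias p s → NoWindowLinSel p →
WalkHardFLinSel p` (`p ≥ 5`), and calibrates the constant: throughout the span regime the class sums are `≤ 2^ℓ/4`
by part I (`classBias_of_wrank`).  The interface is SUFFICIENT, not known necessary; it is the precise target a
three-moduli correlation bound (MOD_3-characters against parities of affine MOD_p tests of the window bits times a
degree-`≤ s` 𝔽₂-phase, wide rank `> ℓ/E`) would have to meet — with constant `1/8`, not with decay. -/

section BiasFibre
variable {L ℓ R : ℕ} (c : ℕ) (y : Fin (L + ℓ + R + 1) → (Fin (L + ℓ + R) → Bool) → Bool)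

/-- **BIAS FIBRE THEOREM** (no prime, no representation: the game alone).  If on an outside fibre `(a, b)` every
live-class sum `Σ_v (−1)^{classPar_r(v)} ω^{|v|}` has norm `≤ X` with `4·(1 + X) ≤ 2^ℓ` — e.g. `X = 2^ℓ/8` once
`ℓ ≥ 3` — then `12·#WIN_fibre ≤ 11·2^ℓ`.  The window laws of parts C, H, I all pass through this inequality with an
EXPONENTIALLY small `X`; a CONSTANT fraction of `2^ℓ` is all the game needs (two-liveness, `three_mul_win_fibre_le_of_bound`). -/
theorem twelve_mul_win_fibre_le_of_bias (hgap : CutFree y L ℓ) {X : ℝ} (hX4 : 4 * (1 + X) ≤ (2 : ℝ) ^ ℓ)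
    (a : Fin L → Bool) (b : Fin R → Bool)
    (hV : ∀ r : ℕ, ‖∑ v : Fin ℓ → Bool, GowersCube.signChar (classPar c y a b r v) * omega3 ^ wt v‖ ≤ X) :
    12 * (univ.filter fun v : Fin ℓ → Bool => ringWinU c y (glue3 a v b) = true).card ≤ 11 * 2 ^ ℓ := by
  have h3 := three_mul_win_fibre_le_of_bound c y hgap a b hV
  have h : (12 : ℝ) * ((univ.filter fun v : Fin ℓ → Bool => ringWinU c y (glue3 a v b) = true).card : ℝ) ≤
      11 * (2 : ℝ) ^ ℓ := by linarith
  exact_mod_cast h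

/-- `ℓ ≥ 3` makes `X = 2^ℓ/8` admissible: `4·(1 + 2^ℓ/8) ≤ 2^ℓ`. -/
theorem four_mul_one_add_le_two_pow (hℓ : 3 ≤ ℓ) : 4 * (1 + (2 : ℝ) ^ ℓ / 8) ≤ (2 : ℝ) ^ ℓ := by
  have h8 : (8 : ℝ) ≤ (2 : ℝ) ^ ℓ := by
    calc (8 : ℝ) = 2 ^ 3 := by norm_num
      _ ≤ 2 ^ ℓ := pow_le_pow_right₀ (by norm_num) hℓ
  linarith

end BiasFibre

/-- **BIAS WINDOW THEOREM** (Fubini over the outside fibres): a uniform live-class-sum bound `X` with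
`4·(1 + X) ≤ 2^ℓ` on every outside fibre ⟹ `12·#WIN ≤ 11·2ⁿ`. -/
theorem window_bound_of_bias (L ℓ R : ℕ) (c : ℕ) (y : Fin (L + ℓ + R + 1) → (Fin (L + ℓ + R) → Bool) → Bool)
    (hgap : CutFree y L ℓ) {X : ℝ} (hX4 : 4 * (1 + X) ≤ (2 : ℝ) ^ ℓ)
    (hV : ∀ (a : Fin L → Bool) (b : Fin R → Bool) (r : ℕ),
      ‖∑ v : Fin ℓ → Bool, GowersCube.signChar (classPar c y a b r v) * omega3 ^ wt v‖ ≤ X) :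
    12 * (univ.filter fun u : Fin (L + ℓ + R) → Bool => ringWinU c y u = true).card ≤ 11 * 2 ^ (L + ℓ + R) := by
  rw [card_filter_eq_sum_glue3 (fun w => ringWinU c y w = true), Finset.mul_sum]
  calc ∑ a : Fin L → Bool, 12 * ∑ b : Fin R → Bool,
        (univ.filter fun v : Fin ℓ → Bool => ringWinU c y (glue3 a v b) = true).card
      ≤ ∑ _a : Fin L → Bool, 2 ^ R * (11 * 2 ^ ℓ) := by
        refine Finset.sum_le_sum fun a _ => ?_
        rw [Finset.mul_sum]
        calc ∑ b : Fin R → Bool, 12 * (univ.filter fun v : Fin ℓ → Bool => ringWinU c y (glue3 a v b) = true).card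
            ≤ ∑ _b : Fin R → Bool, 11 * 2 ^ ℓ :=
              Finset.sum_le_sum fun b _ => twelve_mul_win_fibre_le_of_bias c y hgap hX4 a b (hV a b)
          _ = 2 ^ R * (11 * 2 ^ ℓ) := by
            rw [Finset.sum_const, Finset.card_univ, Fintype.card_fun, Fintype.card_bool, Fintype.card_fin,
              smul_eq_mul]
    _ = 2 ^ L * (2 ^ R * (11 * 2 ^ ℓ)) := by
        rw [Finset.sum_const, Finset.card_univ, Fintype.card_fun, Fintype.card_bool, Fintype.card_fin,
          smul_eq_mul]
    _ = 11 * 2 ^ (L + ℓ + R) := by rw [pow_add, pow_add]; ring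

section BiasPieces
variable (p : ℕ) [Fact p.Prime]

/-- **INTERFACE `SpreadClassBias p s`** (the analytic form of the spread residual): in the spread regime — linear
tests, a cut-free window of length `ℓ ≥ C·(log₂ n + 1)`, and wide cuts (window support `> s`) that do NOT answer
through `ℓ/E` linear forms of the window (`¬ WRankLE p y lam s (ℓ/E)`) — every live-class sum on every outside
fibre has norm at most `2^ℓ/8`.  A CONSTANT-fraction bound, not decay: this is exactly the margin the two-liveness
chain needs.  In words it is a three-moduli correlation statement (`MOD_3`-characters `ω^{|v|}` against the parity of
affine `MOD_p` tests of the window bits times a degree-`≤ s` 𝔽₂-phase).  [SUFFICIENT for the spread piece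
(`spread_of_classBias`); not known to be necessary; IDEA-NEEDED.] -/
def SpreadClassBias (s : ℕ) : Prop :=
  ∀ E : ℕ, 0 < E → ∃ C : ℕ, ∃ n₀ : ℕ, ∀ L ℓ R : ℕ, n₀ ≤ L + ℓ + R →
    C * (Nat.log 2 (L + ℓ + R) + 1) ≤ ℓ →
    ∀ (c : ℕ) (y : Fin (L + ℓ + R + 1) → (Fin (L + ℓ + R) → Bool) → Bool)
      (lam : Fin (L + ℓ + R + 1) → Fin (L + ℓ + R) → ZMod p) (rr : Fin (L + ℓ + R + 1) → ZMod p),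
      (∀ g u, y g u = decide ((∑ i, if u i then lam g i else 0) = rr g)) → CutFree y L ℓ →
      ¬ WRankLE p y lam s (ℓ / E) →
      ∀ (a : Fin L → Bool) (b : Fin R → Bool) (r : ℕ),
        ‖∑ v : Fin ℓ → Bool, GowersCube.signChar (classPar c y a b r v) * omega3 ^ wt v‖ ≤ (2 : ℝ) ^ ℓ / 8

/-- **Class bias ⟹ the spread piece** (`θ = 11/12`; the window-length constant is raised to `max C 3` so that
`ℓ ≥ 3`). -/
theorem spread_of_classBias (s : ℕ) (h : SpreadClassBias p s) : WindowSpreadLinSel p s := by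
  intro E hE
  obtain ⟨C, n₀, h⟩ := h E hE
  refine ⟨11 / 12, by norm_num, max C 3, n₀, fun L ℓ R hn hCle c y lam rr hyl hgap hW => ?_⟩
  have hlog : 1 ≤ Nat.log 2 (L + ℓ + R) + 1 := Nat.le_add_left 1 _
  have hC : C * (Nat.log 2 (L + ℓ + R) + 1) ≤ ℓ := le_trans (Nat.mul_le_mul_right _ (le_max_left C 3)) hCle
  have h3 : 3 ≤ ℓ := le_trans (le_trans (le_max_right C 3) (Nat.le_mul_of_pos_right _ hlog)) hCle
  have hb := window_bound_of_bias L ℓ R c y hgap (four_mul_one_add_le_two_pow h3)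
    (fun a b r => h L ℓ R hn hC c y lam rr hyl hgap hW a b r)
  have h' : (12 : ℝ) * ((univ.filter fun u : Fin (L + ℓ + R) → Bool => ringWinU c y u = true).card : ℝ) ≤
      11 * (2 : ℝ) ^ (L + ℓ + R) := by exact_mod_cast hb
  linarith

/-- **R5 from class bias** (`p ≥ 5`): `SpreadClassBias p s ∧ NoWindowLinSel p ⟹ WalkHardFLinSel p`. -/
theorem r5_of_classBias (hp : 5 ≤ p) (s : ℕ) (hB : SpreadClassBias p s) (hN : NoWindowLinSel p) :
    WalkHardFLinSel p :=
  r5_residual_spread p hp s (spread_of_classBias p s hB) hN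

/-- **Class bias in the SPAN regime is a theorem** (sanity / calibration of the constant `1/8`): with the span
budget `(p·D + 2)·M ≤ ℓ`, `2·4^{s+1} ≤ M·η_p`, `p ≠ 3`, every live-class sum is `≤ 2^ℓ/8` — indeed
`≤ p^D·2^ℓ·e^{−η_p ℓ/4^{s+1}} ≤ 2^ℓ/4 − 1 ≤ …`; we record the clean consequence `≤ 2^ℓ / 4`. -/
theorem classBias_of_wrank (hp3 : p ≠ 3) {L ℓ R : ℕ} (c : ℕ)
    (y : Fin (L + ℓ + R + 1) → (Fin (L + ℓ + R) → Bool) → Bool)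
    (lam : Fin (L + ℓ + R + 1) → Fin (L + ℓ + R) → ZMod p) (rr : Fin (L + ℓ + R + 1) → ZMod p)
    (hyl : ∀ g u, y g u = decide ((∑ i, if u i then lam g i else 0) = rr g))
    {s M D : ℕ} (hM : 2 * 4 ^ (s + 1) ≤ (M : ℝ) * etaP p) (hWR : WRankLE p y lam s D)
    (hℓ : (p * D + 2) * M ≤ ℓ) (a : Fin L → Bool) (b : Fin R → Bool) (r : ℕ) :
    ‖∑ v : Fin ℓ → Bool, GowersCube.signChar (classPar c y a b r v) * omega3 ^ wt v‖ ≤ (2 : ℝ) ^ ℓ / 4 := by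
  have hX := le_trans (norm_classSum_le_wrank c y lam rr hp3 hyl a b r hWR)
    (mul_le_mul_of_nonneg_right (pow_le_three_pow_mul (p := p) D) (by positivity))
  have hE := mixed_err_absorb (etaP_pos (p := p)) (etaP_le_two p) hM hℓ
  have hnn : (0 : ℝ) ≤ 3 ^ (p * D) * (2 ^ ℓ * Real.exp (-(etaP p * ℓ / 4 ^ (s + 1)))) := by positivity
  linarith

/-- **THE BIAS DIAL** (`p ≥ 5`): the spread residual follows from the class-bias interface, and the interface is
met (with room) throughout the span regime. -/
theorem bias_dial (hp : 5 ≤ p) :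
    (∀ s, SpreadClassBias p s → WindowSpreadLinSel p s) ∧
      (∀ s, SpreadClassBias p s → NoWindowLinSel p → WalkHardFLinSel p) :=
  ⟨spread_of_classBias p, r5_of_classBias p hp⟩

end BiasPieces

end Summit.QuantumAdvantage.QuantumAdvantage.Theorems.RankDial

end
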